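import Summits.RiemannHypothesis.RiemannHypothesis.Theorems.PfPersistenceEdgeLawCuspCoord
import Summits.RiemannHypothesis.RiemannHypothesis.Theorems.PfPersistenceEdgeLawLipIncrement
import Summits.RiemannHypothesis.RiemannHypothesis.Theorems.PfPersistenceEdgeLawPohozaev

/-!
# Edge law — the cusp modulus of a window state and the interior defect (RH-free)

Part of the pub-rhpf THEORY-2 programme (mechanism / rigidity of the Weil window bottom; no RH
claims). The **cusp modulus hypothesis** `HasCuspModulus a u C` says that the open-window
truncation `ũ = 1_{(-a,a)} u` is `C`-Lipschitz in the cusp coordinate `Γ_a` of the window: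
`‖ũ(y) − ũ(x)‖ ≤ C (Γ_a(y) − Γ_a(x))` for `−a ≤ x ≤ y ≤ a`. It is the logarithmic analogue of the
boundary gradient bound of Ros-Oton–Serra for the fractional Dirichlet problem and holds for the
cusp model `τ/√(log 1/(a−|x|))`; it is a HYPOTHESIS on the Weil ground state (nothing here proves
it). Under it the interior dilation defect `t_η` (the dilation defect with its edge layers
removed, `weilInteriorDefect`) is controlled explicitly:

* `weilInteriorDefect_eq_indicator`: `t_η = 1_{[-b,b]} · (√(1+η) ũ((1+η)·) − ũ)`, `b = a/(1+η)`;
* `weilIncrement_weilInteriorDefect_le`: `D_s(t_η) ≤ s C² (25 G(a) G(2h) + 72 G(2h)²)` for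
  `0 < s ≤ h = h(η)` (`G = cuspPrim a`);
* the mass bound is in `PfPersistenceEdgeLawCuspMass`, the `o(η)` conclusion (R3) in
  `PfPersistenceEdgeLawCuspDefect`.

Sources: E. Bombieri, *Remarks on Weil's quadratic functional in the theory of prime numbers I*,
Rend. Mat. Acc. Lincei (9) 11 (2000) §4 (proof of Thm 5: the dilation); X. Ros-Oton, J. Serra,
J. Math. Pures Appl. 101 (2014) Thm 1.2 (the model gradient bound).
-/

set_option linter.dupNamespace false

noncomputable section

open MeasureTheory Set Filter
open scoped Topology ENNReal

namespace Summit.RiemannHypothesis.RiemannHypothesis.Theorems.PfPersistence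

open Literature.NumberTheory.LFunctions

variable {a : ℝ} {u : ℝ → ℂ}

/-! ## The interior defect as a compactly supported germ -/

/-- `a − h(η) = a/(1+η)` (`η > -1`). [folklore] -/
theorem sub_layerDepth {η : ℝ} (hη : -1 < η) : a - layerDepth a η = a / (1 + η) := by
  have : (1 + η) ≠ 0 := by linarith
  unfold layerDepth
  field_simp
  ring

/-- `h(η) = η · a/(1+η)`. [folklore] -/
theorem layerDepth_eq_mul {η : ℝ} : layerDepth a η = η * (a / (1 + η)) := by
  unfold layerDepth
  ring

/-- `h(η) ≤ a/2` for `0 ≤ η ≤ 1` (`a ≥ 0`). [folklore] -/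
theorem layerDepth_le_half (ha : 0 ≤ a) {η : ℝ} (hη : 0 ≤ η) (hη1 : η ≤ 1) :
    layerDepth a η ≤ a / 2 := by
  unfold layerDepth
  rw [div_le_div_iff₀ (by linarith) two_pos]
  nlinarith

/-- `h(η) ≤ a/(1+η)` for `0 ≤ η ≤ 1` (`a ≥ 0`). [folklore] -/
theorem layerDepth_le_window (ha : 0 ≤ a) {η : ℝ} (hη : 0 ≤ η) (hη1 : η ≤ 1) :
    layerDepth a η ≤ a / (1 + η) := by
  rw [layerDepth_eq_mul]
  have : 0 ≤ a / (1 + η) := div_nonneg ha (by linarith)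
  nlinarith

/-- `h(η) ≤ a η` for `η ≥ 0` (`a ≥ 0`). [folklore] -/
theorem layerDepth_le_mul (ha : 0 ≤ a) {η : ℝ} (hη : 0 ≤ η) : layerDepth a η ≤ a * η := by
  unfold layerDepth
  rw [div_le_iff₀ (by linarith)]
  nlinarith [mul_nonneg ha hη]

/-- The **dilation germ** `g_η(x) = √(1+η) ũ((1+η)x) − ũ(x)` of a window state. [folklore] -/
def dilationGerm (a : ℝ) (u : ℝ → ℂ) (η : ℝ) : ℝ → ℂ :=
  fun x ↦ (Real.sqrt (1 + η) : ℂ) * weilTrunc a u ((1 + η) * x) - weilTrunc a u x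

/-- **The interior defect is the germ cut at the compressed window**:
`t_η = 1_{[-a/(1+η), a/(1+η)]} · g_η` (everywhere, `η > 0`). [folklore] -/
theorem weilInteriorDefect_eq_indicator {η : ℝ} (hη : 0 < η) :
    weilInteriorDefect a u η =
      (Icc (-(a / (1 + η))) (a / (1 + η))).indicator (dilationGerm a u η) := by
  have hη1 : 0 < 1 + η := by linarith
  funext x
  unfold weilInteriorDefect weilDilationDefect weilEdgeLayer
  rw [sub_layerDepth (by linarith), Pi.add_apply, Pi.sub_apply, weilDilate_apply]
  by_cases hx : x ∈ Icc (-(a / (1 + η))) (a / (1 + η))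
  · rw [indicator_of_mem hx, indicator_of_notMem (fun h : x ∈ {y : ℝ | a / (1 + η) < |y|} ↦
      (abs_le.2 hx).not_gt h), add_zero]
    rfl
  · have hx' : a / (1 + η) < |x| := by
      by_contra h
      exact hx (abs_le.1 (not_lt.1 h))
    have hz : weilTrunc a u ((1 + η) * x) = 0 := by
      refine weilTrunc_eq_zero u ?_
      rw [abs_mul, abs_of_pos hη1]
      rw [div_lt_iff₀ hη1] at hx'
      linarith
    rw [indicator_of_notMem hx, indicator_of_mem (show x ∈ {y : ℝ | a / (1 + η) < |y|} from hx'),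
      hz, mul_zero, zero_sub, neg_add_cancel]

/-- A point of the compressed window dilates into the window. [folklore] -/
theorem window_of_mem_compressed {η z : ℝ} (hη0 : 0 < 1 + η) (hz1 : -(a / (1 + η)) ≤ z)
    (hz2 : z ≤ a / (1 + η)) : -a ≤ (1 + η) * z ∧ (1 + η) * z ≤ a := by
  have e : (1 + η) * (a / (1 + η)) = a := by field_simp
  have h1 := mul_le_mul_of_nonneg_left hz1 hη0.le
  have h2 := mul_le_mul_of_nonneg_left hz2 hη0.le
  rw [mul_neg, e] at h1
  rw [e] at h2
  exact ⟨h1, h2⟩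

/-! ## The cusp modulus hypothesis -/

/-- **Cusp modulus** (RH-free regularity HYPOTHESIS on a window state): the open-window truncation
`ũ` is `C`-Lipschitz in the cusp coordinate, `‖ũ(y) − ũ(x)‖ ≤ C (Γ_a(y) − Γ_a(x))` for
`−a ≤ x ≤ y ≤ a`. [folklore] -/
def HasCuspModulus (a : ℝ) (u : ℝ → ℂ) (C : ℝ) : Prop :=
  ∀ ⦃x y : ℝ⦄, -a ≤ x → x ≤ y → y ≤ a →
    ‖weilTrunc a u y - weilTrunc a u x‖ ≤ C * (cuspCoord a y - cuspCoord a x)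

namespace HasCuspModulus

variable {C : ℝ}

/-- The modulus constant is nonnegative (`a > 0`). [folklore] -/
theorem nonneg (hC : HasCuspModulus a u C) (ha : 0 < a) : 0 ≤ C := by
  have h := hC (x := -a) (y := a) le_rfl (by linarith) le_rfl
  rw [cuspCoord_self ha.le, cuspCoord_neg_self ha.le] at h
  have hG : 0 < cuspPrim a a := by
    unfold cuspPrim
    exact div_pos two_pos (Real.sqrt_pos.2 (cuspLog_pos ha le_rfl))
  nlinarith [norm_nonneg (weilTrunc a u a - weilTrunc a u (-a))]

/-- **Cusp profile**: `‖ũ(y)‖ ≤ C G(a − |y|)` for `|y| ≤ a`. [folklore] -/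
theorem norm_le (hC : HasCuspModulus a u C) {y : ℝ} (hy : |y| ≤ a) :
    ‖weilTrunc a u y‖ ≤ C * cuspPrim a (a - |y|) := by
  have ha : 0 ≤ a := (abs_nonneg y).trans hy
  rcases le_or_gt 0 y with h0 | h0
  · rw [abs_of_nonneg h0] at hy ⊢
    have h := hC (x := y) (y := a) (by linarith) hy le_rfl
    rw [weilTrunc_eq_zero u (le_of_eq (abs_of_nonneg ha).symm), zero_sub, norm_neg,
      cuspCoord_self ha, cuspCoord_of_nonneg a h0] at h
    linarith
  · rw [abs_of_neg h0] at hy ⊢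
    have h := hC (x := -a) (y := y) (by linarith) (by linarith) (by linarith)
    rw [weilTrunc_eq_zero u (x := -a) (by rw [abs_neg, abs_of_nonneg ha]), sub_zero,
      cuspCoord_neg_self ha, cuspCoord_of_nonpos a h0.le] at h
    have : a + y = a - -y := by ring
    rw [← this]
    linarith

/-- **Sup bound**: `‖ũ(y)‖ ≤ C G(a)` everywhere (`a > 0`). [folklore] -/
theorem norm_le_prim (hC : HasCuspModulus a u C) (ha : 0 < a) (y : ℝ) :
    ‖weilTrunc a u y‖ ≤ C * cuspPrim a a := by
  rcases le_or_gt (|y|) a with hy | hy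
  · exact (hC.norm_le hy).trans (mul_le_mul_of_nonneg_left
      (cuspPrim_mono (by linarith [abs_nonneg y]) (by linarith [abs_nonneg y]) le_rfl) (hC.nonneg ha))
  · rw [weilTrunc_eq_zero u hy.le, norm_zero]
    exact mul_nonneg (hC.nonneg ha) (cuspPrim_nonneg a a)

/-- The dilation increment in the cusp coordinate: for `|x| ≤ a/(1+η)` (`0 ≤ η ≤ 1`),
`‖ũ((1+η)x) − ũ(x)‖ ≤ C (Γ(|x| + h) − Γ(|x|))`. [folklore] -/
theorem norm_sub_dilate_le (hC : HasCuspModulus a u C) (ha : 0 < a) {η : ℝ} (hη : 0 ≤ η)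
    (hη1 : η ≤ 1) {x : ℝ} (hx : |x| ≤ a / (1 + η)) :
    ‖weilTrunc a u ((1 + η) * x) - weilTrunc a u x‖ ≤
      C * (cuspCoord a (|x| + layerDepth a η) - cuspCoord a |x|) := by
  have hη0 : 0 < 1 + η := by linarith
  have hC0 := hC.nonneg ha
  have hb : a / (1 + η) ≤ a := div_le_self ha.le (by linarith)
  have hxa : (1 + η) * |x| ≤ a := by rwa [le_div_iff₀ hη0, mul_comm] at hx
  have hh : layerDepth a η = η * (a / (1 + η)) := layerDepth_eq_mul
  have hmono : cuspCoord a ((1 + η) * |x|) ≤ cuspCoord a (|x| + layerDepth a η) := by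
    have h0 : 0 ≤ (1 + η) * |x| := mul_nonneg hη0.le (abs_nonneg x)
    refine cuspCoord_mono (a := a) (by linarith) ?_ ?_
    · rw [hh]; nlinarith [abs_nonneg x]
    · have := layerDepth_le_window ha.le hη hη1
      calc |x| + layerDepth a η ≤ a / (1 + η) + η * (a / (1 + η)) := by rw [← hh]; linarith
        _ = a := by field_simp
  have key : ‖weilTrunc a u ((1 + η) * x) - weilTrunc a u x‖ ≤
      C * (cuspCoord a ((1 + η) * |x|) - cuspCoord a |x|) := by
    rcases le_or_gt 0 x with h0 | h0
    · rw [abs_of_nonneg h0] at hxa ⊢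
      exact hC (by linarith) (by nlinarith) hxa
    · have hxn : |x| = -x := abs_of_neg h0
      rw [hxn] at hxa
      have h := hC (x := (1 + η) * x) (y := x) (by linarith) (by nlinarith) (by linarith [abs_nonneg x])
      rw [norm_sub_rev] at h
      rw [hxn, show (1 + η) * -x = -((1 + η) * x) by ring, cuspCoord_neg, cuspCoord_neg]
      linarith
  exact key.trans (mul_le_mul_of_nonneg_left (by linarith) hC0)

end HasCuspModulus

/-! ## The germ under a cusp modulus -/

/-- `√(1+η) − 1 ≤ η` for `η ≥ 0`. [folklore] -/
theorem sqrt_one_add_sub_one_le {η : ℝ} (hη : 0 ≤ η) : Real.sqrt (1 + η) - 1 ≤ η := by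
  have : Real.sqrt (1 + η) ≤ 1 + η := by
    rw [Real.sqrt_le_left (by linarith)]
    nlinarith
  linarith

/-- `√(1+η) ≤ 3/2` for `η ≤ 1`. [folklore] -/
theorem sqrt_one_add_le {η : ℝ} (hη1 : η ≤ 1) : Real.sqrt (1 + η) ≤ 3 / 2 := by
  rw [Real.sqrt_le_left (by norm_num)]
  linarith

/-- **Germ bound**: `‖g_η(x)‖ ≤ C (η G(a) + (Γ(|x|+h) − Γ(|x|)))` for `|x| ≤ a/(1+η)`.
[folklore] -/
theorem norm_dilationGerm_le {C : ℝ} (hC : HasCuspModulus a u C) (ha : 0 < a) {η : ℝ}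
    (hη : 0 ≤ η) (hη1 : η ≤ 1) {x : ℝ} (hx : |x| ≤ a / (1 + η)) :
    ‖dilationGerm a u η x‖ ≤
      C * (η * cuspPrim a a + (cuspCoord a (|x| + layerDepth a η) - cuspCoord a |x|)) := by
  have hC0 := hC.nonneg ha
  have h1 : ‖((Real.sqrt (1 + η) : ℂ) - 1) * weilTrunc a u ((1 + η) * x)‖ ≤
      η * (C * cuspPrim a a) := by
    rw [norm_mul, show ((Real.sqrt (1 + η) : ℂ) - 1) = ((Real.sqrt (1 + η) - 1 : ℝ) : ℂ) by
      push_cast; ring, Complex.norm_real, Real.norm_eq_abs,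
      abs_of_nonneg (by linarith [Real.one_le_sqrt.2 (by linarith : (1 : ℝ) ≤ 1 + η)])]
    exact mul_le_mul (sqrt_one_add_sub_one_le hη) (hC.norm_le_prim ha _) (norm_nonneg _)
      hη
  have h2 := hC.norm_sub_dilate_le ha hη hη1 hx
  have e : dilationGerm a u η x = ((Real.sqrt (1 + η) : ℂ) - 1) * weilTrunc a u ((1 + η) * x)
      + (weilTrunc a u ((1 + η) * x) - weilTrunc a u x) := by
    unfold dilationGerm; ring
  rw [e]
  refine (norm_add_le _ _).trans ?_
  nlinarith

/-- The **dilation coordinate** `Θ_η(z) = (3/2) Γ((1+η)z) + Γ(z)`: the germ is `C`-Lipschitz in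
it. [folklore] -/
def dilationCoord (a η : ℝ) : ℝ → ℝ :=
  fun z ↦ 3 / 2 * cuspCoord a ((1 + η) * z) + cuspCoord a z

/-- `Θ_η` is increasing on the compressed window. [folklore] -/
theorem dilationCoord_monotoneOn (ha : 0 < a) {η : ℝ} (hη : 0 ≤ η) :
    MonotoneOn (dilationCoord a η) (Icc (-(a / (1 + η))) (a / (1 + η))) := by
  have hη0 : 0 < 1 + η := by linarith
  have hb : a / (1 + η) ≤ a := div_le_self ha.le (by linarith)
  intro x hx y hy hxy
  have hxa := (window_of_mem_compressed hη0 hx.1 hx.2).1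
  have hya := (window_of_mem_compressed hη0 hy.1 hy.2).2
  unfold dilationCoord
  have h1 := cuspCoord_mono hxa (by nlinarith : (1 + η) * x ≤ (1 + η) * y) hya
  have h2 := cuspCoord_mono (a := a) (x := x) (y := y) (by linarith [hx.1]) hxy (by linarith [hy.2])
  linarith

/-- **The germ is `C`-Lipschitz in `Θ_η`** on the compressed window (`0 ≤ η ≤ 1`). [folklore] -/
theorem norm_dilationGerm_sub_le {C : ℝ} (hC : HasCuspModulus a u C) (ha : 0 < a) {η : ℝ}
    (hη : 0 ≤ η) (hη1 : η ≤ 1) {x y : ℝ} (hx : -(a / (1 + η)) ≤ x) (hxy : x ≤ y)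
    (hy : y ≤ a / (1 + η)) :
    ‖dilationGerm a u η y - dilationGerm a u η x‖ ≤
      C * (dilationCoord a η y - dilationCoord a η x) := by
  have hη0 : 0 < 1 + η := by linarith
  have hC0 := hC.nonneg ha
  have hb : a / (1 + η) ≤ a := div_le_self ha.le (by linarith)
  have hxa := (window_of_mem_compressed hη0 hx (hxy.trans hy)).1
  have hya := (window_of_mem_compressed hη0 (hx.trans hxy) hy).2
  have hxy' : (1 + η) * x ≤ (1 + η) * y := by nlinarith
  have h1 := hC hxa hxy' hya
  have h2 := hC (x := x) (y := y) (by linarith) hxy (by linarith)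
  have h3 : 0 ≤ cuspCoord a ((1 + η) * y) - cuspCoord a ((1 + η) * x) :=
    sub_nonneg.2 (cuspCoord_mono hxa hxy' hya)
  have hs := sqrt_one_add_le hη1
  have hs0 : 0 ≤ Real.sqrt (1 + η) := Real.sqrt_nonneg _
  have e : dilationGerm a u η y - dilationGerm a u η x =
      (Real.sqrt (1 + η) : ℂ) * (weilTrunc a u ((1 + η) * y) - weilTrunc a u ((1 + η) * x)) -
        (weilTrunc a u y - weilTrunc a u x) := by
    unfold dilationGerm; ring
  rw [e]
  refine (norm_sub_le _ _).trans ?_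
  rw [norm_mul, Complex.norm_real, Real.norm_eq_abs, abs_of_nonneg hs0]
  unfold dilationCoord
  nlinarith [mul_le_mul hs h1 (norm_nonneg _) (by norm_num : (0 : ℝ) ≤ 3 / 2),
    mul_nonneg hC0 h3]

/-- **Modulus of `Θ_η` at the layer scale**: for `x ≤ y ≤ x + s` in the compressed window with
`s ≤ h(η)` (`0 ≤ η ≤ 1`), `Θ_η(y) − Θ_η(x) ≤ 5 G(2h)`. [folklore] -/
theorem dilationCoord_sub_le (ha : 0 < a) {η : ℝ} (hη : 0 ≤ η) (hη1 : η ≤ 1) {x y s : ℝ}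
    (hx : -(a / (1 + η)) ≤ x) (hxy : x ≤ y) (hy : y ≤ a / (1 + η)) (hys : y ≤ x + s)
    (hs : s ≤ layerDepth a η) :
    dilationCoord a η y - dilationCoord a η x ≤ 5 * cuspPrim a (2 * layerDepth a η) := by
  have hη0 : 0 < 1 + η := by linarith
  have hb : a / (1 + η) ≤ a := div_le_self ha.le (by linarith)
  have hh2 : 2 * layerDepth a η ≤ a := by linarith [layerDepth_le_half ha.le hη hη1]
  have hxa := (window_of_mem_compressed hη0 hx (hxy.trans hy)).1
  have hya := (window_of_mem_compressed hη0 (hx.trans hxy) hy).2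
  have hxy' : (1 + η) * x ≤ (1 + η) * y := by nlinarith
  have hsh : s ≤ layerDepth a η := hs
  have hh0 : 0 ≤ layerDepth a η := by
    rw [layerDepth_eq_mul]; exact mul_nonneg hη (div_nonneg ha.le hη0.le)
  have hd1 : (1 + η) * y - (1 + η) * x ≤ 2 * layerDepth a η := by nlinarith
  have hd2 : y - x ≤ 2 * layerDepth a η := by linarith
  have h1 := cuspCoord_sub_le hxa hxy' hya (by linarith)
  have h1' := cuspPrim_mono (a := a) (by nlinarith : 0 ≤ (1 + η) * y - (1 + η) * x) hd1 hh2
  have h2 := cuspCoord_sub_le (a := a) (x := x) (y := y) (by linarith) hxy (by linarith) (by linarith)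
  have h2' := cuspPrim_mono (a := a) (by linarith : 0 ≤ y - x) hd2 hh2
  unfold dilationCoord
  linarith

/-- `Θ_η(b) − Θ_η(−b) ≤ 5 G(a)` on the compressed window `b = a/(1+η)`. [folklore] -/
theorem dilationCoord_width (ha : 0 < a) {η : ℝ} (hη : 0 ≤ η) :
    dilationCoord a η (a / (1 + η)) - dilationCoord a η (-(a / (1 + η))) ≤ 5 * cuspPrim a a := by
  have hη0 : 0 < 1 + η := by linarith
  have hb : a / (1 + η) ≤ a := div_le_self ha.le (by linarith)
  have hb0 : 0 ≤ a / (1 + η) := div_nonneg ha.le hη0.le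
  unfold dilationCoord
  rw [show (1 + η) * (a / (1 + η)) = a by field_simp, show (1 + η) * -(a / (1 + η)) = -a by
    field_simp, cuspCoord_self ha.le, cuspCoord_neg_self ha.le, cuspCoord_neg]
  have h1 := cuspCoord_le (a := a) (y := a / (1 + η)) (by linarith)
  have h2 := cuspCoord_nonneg hb0 hb
  linarith

/-! ## Increments of the interior defect -/

/-- **Increments of the interior defect under a cusp modulus**: for `0 < s ≤ h(η)`
(`0 < η ≤ 1`), `D_s(t_η) ≤ s C² (25 G(a) G(2h) + 72 G(2h)²)`.
[cite: Bombieri2000Weil, §4 proof of Thm 5 (the dilation)] -/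
theorem weilIncrement_weilInteriorDefect_le {C : ℝ} (hC : HasCuspModulus a u C) (ha : 0 < a)
    {η : ℝ} (hη : 0 < η) (hη1 : η ≤ 1) {s : ℝ} (hs : 0 < s) (hsh : s ≤ layerDepth a η) :
    weilIncrement (weilInteriorDefect a u η) s ≤
      s * (C ^ 2 * (25 * cuspPrim a a * cuspPrim a (2 * layerDepth a η) +
        72 * cuspPrim a (2 * layerDepth a η) ^ 2)) := by
  have hη0 : 0 < 1 + η := by linarith
  have hC0 := hC.nonneg ha
  set b := a / (1 + η) with hb_def
  set r := cuspPrim a (2 * layerDepth a η) with hr_def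
  have hb : b ≤ a := div_le_self ha.le (by linarith)
  have hhb : layerDepth a η ≤ b := layerDepth_le_window ha.le hη.le hη1
  have hh0 : 0 < layerDepth a η := layerDepth_pos ha hη
  have hh2 : 2 * layerDepth a η ≤ a := by linarith [layerDepth_le_half ha.le hη.le hη1]
  have hr1 : cuspPrim a (layerDepth a η) ≤ r := cuspPrim_mono hh0.le (by linarith) hh2
  have hab : a - b = layerDepth a η := by
    rw [hb_def, ← sub_layerDepth (a := a) (by linarith : (-1 : ℝ) < η)]; ring
  rw [weilInteriorDefect_eq_indicator hη]
  -- endpoint values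
  have hJ : ∀ z, |z| = b → ‖(Icc (-b) b).indicator (dilationGerm a u η) z‖ ≤ C * r := by
    intro z hz
    have hzm : z ∈ Icc (-b) b := abs_le.1 hz.le
    rw [indicator_of_mem hzm, dilationGerm, weilTrunc_eq_zero u (x := (1 + η) * z)
      (by rw [abs_mul, abs_of_pos hη0, hz, hb_def]; field_simp; rfl), mul_zero, zero_sub,
      norm_neg]
    have := hC.norm_le (y := z) (by rw [hz]; exact hb)
    rw [hz, hab] at this
    nlinarith
  have hmain := weilIncrement_le_of_lipschitzCoord (t := (Icc (-b) b).indicator (dilationGerm a u η))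
    (Θ := dilationCoord a η) (C := C) (J := C * r) (ω := 5 * r) hs (by linarith) hC0
    (fun x hx ↦ indicator_of_notMem hx _) (dilationCoord_monotoneOn ha hη.le)
    (fun x hx y hy hxy ↦ by
      rw [indicator_of_mem hx, indicator_of_mem hy]
      exact norm_dilationGerm_sub_le hC ha hη.le hη1 hx.1 hxy hy.2)
    (fun x hx y hy hxy hys ↦ dilationCoord_sub_le ha hη.le hη1 hx.1 hxy hy.2 hys hsh)
    (hJ b (abs_of_nonneg (by linarith))) (hJ (-b) (by rw [abs_neg, abs_of_nonneg (by linarith)]))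
  have hw := dilationCoord_width ha hη.le
  have hr0 : 0 ≤ r := cuspPrim_nonneg _ _
  have hG0 : 0 ≤ cuspPrim a a := cuspPrim_nonneg _ _
  calc weilIncrement ((Icc (-b) b).indicator (dilationGerm a u η)) s
      ≤ s * (C ^ 2 * (5 * r) * (dilationCoord a η b - dilationCoord a η (-b)) +
          2 * (C * (5 * r) + C * r) ^ 2) := hmain
    _ ≤ s * (C ^ 2 * (25 * cuspPrim a a * r + 72 * r ^ 2)) := by
        refine mul_le_mul_of_nonneg_left ?_ hs.le
        nlinarith [mul_nonneg (mul_nonneg (sq_nonneg C) hr0) (by linarith : 0 ≤ 5 * cuspPrim a a -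
          (dilationCoord a η b - dilationCoord a η (-b)))]

end Summit.RiemannHypothesis.RiemannHypothesis.Theorems.PfPersistence

end
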